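import Summits.QuantumAdvantage.AdviceFreeQNC0.NearOutLemma
import HarnessLib

/-!
# Cell qa-qnc0 (rung F-Q1, density axis): corollaries of the near-outside lemma — `OutDetermines` from
# the minimum distance, and `NearOutMass` from an optimal `K0` plus two finite code facts

Planner qa-qnc0-p1 Sketch13 v6c (`NearOutEight`: "finite facts: SC₁(8), L = 6, d(C_8) = 58").  With
`nearOutLemma` (`NearOutLemma.lean`) and qn-lit's `sc1At_of_isOpt1`, the near-outside mass inequality at
an OPTIMAL codeword `K0` needs only two finite inputs about the one-block code `C_m`: (i) every non-zero
codeword has weight `> max(|Z(K0)|, L·ρ)` and (ii) the outside dual words are generated in length `≤ L`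
(`DualGenOut m K0 L`).  Indeed (i) gives `OutDetermines` (a codeword vanishing outside `Z` has weight
`≤ |Z|`).

* `outDetermines_of_minDist : (∀ Q, IsElim1 m Q → pwt Q ≠ 0 → failCount K0 < pwt Q) → OutDetermines m K0`;
* `nearOutMass_of_isOpt1 : IsOpt1 m K0 → DualGenOut m K0 L →
    (∀ Q, IsElim1 m Q → pwt Q ≠ 0 → failCount K0 < pwt Q ∧ L * ρ < pwt Q) → NearOutMass m ρ K0`.

So `NearOutEight` ⟸ `d(C_8) = 58 > max(45, 54)` ∧ `DualGenOut 8 K0 6` (both finite, kit-verified by the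
planner; not kernel here).  WHAT THIS IS NOT: those finite facts; the far regime; separation NOT moved.
-/

noncomputable section

namespace Summit.QuantumAdvantage.AdviceFreeQNC0

open Finset
open MassInequality

/-- A codeword vanishing outside `Z(K0)` has weight at most `|Z(K0)| = failCount K0`. -/
theorem pwt_le_failCount_of_vanish_out {m : ℕ} {K0 A : (Fin m → Bool) → Bool}
    (hA : ∀ u, K0 u = true → A u = false) : pwt A ≤ failCount K0 := by
  unfold pwt failCount
  refine card_le_card fun u hu => ?_
  simp only [mem_filter, mem_univ, true_and] at hu ⊢
  cases hK : K0 u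
  · rfl
  · rw [hA u hK] at hu; exact absurd hu Bool.false_ne_true

/-- **`OutDetermines` from the minimum distance**: if every non-zero codeword is heavier than `|Z(K0)|`,
no non-zero codeword vanishes on all of `Z(K0)ᶜ`. -/
theorem outDetermines_of_minDist {m : ℕ} {K0 : (Fin m → Bool) → Bool}
    (hd : ∀ Q, IsElim1 m Q → pwt Q ≠ 0 → failCount K0 < pwt Q) : OutDetermines m K0 := by
  intro A hA hAout u
  by_cases h0 : pwt A = 0
  · unfold pwt at h0
    rw [Finset.card_eq_zero, filter_eq_empty_iff] at h0
    have := h0 (mem_univ u)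
    cases hq : A u
    · rfl
    · exact absurd hq this
  · have h1 := hd A hA h0
    have h2 := pwt_le_failCount_of_vanish_out hAout
    omega

/-- **Near-outside MI at an optimal codeword from two finite code facts**: the minimum non-zero weight of
`C_m` exceeds `|Z(K0)|` and `L·ρ`, and the outside dual words are generated in length `≤ L`. -/
theorem nearOutMass_of_isOpt1 {m : ℕ} {K0 : (Fin m → Bool) → Bool} {L ρ : ℕ} (hK : IsOpt1 m K0)
    (hGen : DualGenOut m K0 L)
    (hd : ∀ Q, IsElim1 m Q → pwt Q ≠ 0 → failCount K0 < pwt Q ∧ L * ρ < pwt Q) :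
    NearOutMass m ρ K0 :=
  nearOutLemma m K0 L ρ (sc1At_of_isOpt1 hK)
    (outDetermines_of_minDist fun Q hQ h0 => (hd Q hQ h0).1) hGen fun Q hQ h0 => (hd Q hQ h0).2

end Summit.QuantumAdvantage.AdviceFreeQNC0
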